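import Summits.NavierStokesRegularity.NavierStokesRegularity.Theorems.FrozenSignCascadeEnvelopeBoundAxisymmetric
import Summits.NavierStokesRegularity.NavierStokesRegularity.Theorems.CertifiedBlowupCertifiedBlowupAxisymBlowupLeiZhangThreshold
import HarnessLib

/-!
# Route FrozenSignCascade · crux `EnvelopeBound` (stmt-NavierStokesRegularity-1549): the Lei–Zhang small-swirl sector

Helper file for the crux item stmt-NavierStokesRegularity-1549 (`EnvelopeBound`, leaf (A) of route
`FrozenSignCascade`), line `registered`, lead c8; landed `--supports` that item; companion of
`FrozenSignCascadeEnvelopeBoundAxisymmetric` (the axisymmetric sector: swirl-free data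
unconditionally, and (A)|axi ⟺ ns.S25).

Here the crux is settled UNCONDITIONALLY on a large-data class WITH swirl: the relative
small-swirl class of Lei–Zhang 2017, Thm. 1.4 — axisymmetric rapidly decaying data `u₀` with
`ω₀^θ/r`, `(u₀^θ)²/r`, `Γ₀ = r u₀^θ ∈ L²` and `‖Γ₀‖_{L^∞} ≤ δ / M₀(u₀)`,
`M₀ = (‖ω₀^θ/r‖_{L²} + ‖(u₀^θ)²/r‖_{L²}) ‖Γ₀‖_{L²}`, `δ > 0` absolute, unit viscosity (the paper's
normalisation; the poloidal part of the datum is of arbitrary size). The tree proves that theorem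
(`LeiZhang2017_smallSwirl_regularity_holds`) and its contrapositive at blow-up data
(`CompactAmplification.swirl_not_small_of_isMaximalSmoothSolution_one`); with the Kato lifespan
dictionary of route CertifiedBlowup (`exists_isMaximalSmoothSolution_of_katoMaximalTime_lt_top`) this
gives `katoMaximalTime 1 u₀ = ∞` on the class (`exists_delta_katoMaximalTime_eq_top_of_smallSwirl`),
and below `T_max` the envelope is bounded (`Kato.envelope_of_lt_katoMaximalTime`, lead c5):
`exists_delta_envelope_of_smallSwirl`.

Nothing here credits the open stub `stub_farFromLeray` (≡ the crux, p160448).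
-- TODO(general form): the paper's `ν = 1` normalisation is kept; the statement for `ν > 0` follows by
-- the Navier–Stokes scaling `u ↦ ν⁻¹ u(ν⁻¹ ·)`… of data, lifespans and Fourier-mild solutions, for
-- which the tree has no packaged lemma at the level of `katoMaximalTime`.

References: Z. Lei, Q. S. Zhang, *Criticality of the axially symmetric Navier–Stokes equations*,
Pacific J. Math. 289 (2017) 169–187, Thm. 1.4; T. Kato, Math. Z. 187 (1984), Thm. 4.
-/

noncomputable section

set_option linter.dupNamespace false -- nested layout Summit.<S>.<Sub>, Sub = S (D-0017)

open Set MeasureTheory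
open scoped ENNReal NNReal ContDiff
open Literature.Analysis.FluidPDE Literature.Analysis.FluidPDE.FourierNS
open Summit.NavierStokesRegularity.NavierStokesRegularity.Theorems.CertifiedBlowupAxisymBlowup

namespace Summit.NavierStokesRegularity.NavierStokesRegularity.Theorems.EnvelopeBound.Axisymmetric

/-- **Lei–Zhang's small-swirl data have infinite Kato maximal time** (`ν = 1`). There is an
absolute `δ > 0` such that every smooth, divergence-free, rapidly decaying, axisymmetric datum `u₀`
with `ω₀^θ/r`, `(u₀^θ)²/r`, `Γ₀ ∈ L²` and `‖Γ₀‖_{L^∞} ≤ δ / M₀(u₀)` has `katoMaximalTime 1 u₀ = ∞`: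
otherwise `exists_isMaximalSmoothSolution_of_katoMaximalTime_lt_top` launches a maximal Leray–Hopf
classical solution of finite lifespan from `u₀`, whose datum cannot have small relative swirl
(`swirl_not_small_of_isMaximalSmoothSolution_one`, the contrapositive of Lei–Zhang 2017, Thm. 1.4).
[cite: LeiZhang2017, Thm. 1.4] -/
theorem exists_delta_katoMaximalTime_eq_top_of_smallSwirl :
    ∃ δ : ℝ, 0 < δ ∧ ∀ {u₀ : EuclideanSpace ℝ (Fin 3) → EuclideanSpace ℝ (Fin 3)},
      ContDiff ℝ ∞ u₀ → VectorCalculus.IsDivFree u₀ → HasRapidSpatialDecay u₀ → IsAxisymmetric u₀ →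
      eLpNorm (LeiZhang2017.bigOmega u₀) 2 volume < ⊤ → eLpNorm (LeiZhang2017.vSq u₀) 2 volume < ⊤ →
      eLpNorm (swirl u₀) 2 volume < ⊤ →
      eLpNorm (swirl u₀) ⊤ volume ≤ ENNReal.ofReal δ / LeiZhang2017.M0 u₀ →
      katoMaximalTime 1 u₀ = ⊤ := by
  obtain ⟨δ, hδ, h⟩ := CompactAmplification.swirl_not_small_of_isMaximalSmoothSolution_one
  refine ⟨δ, hδ, fun {u₀} hsm hdiv hdec hax hΩ hV hΓ hsmall => ?_⟩
  by_contra htop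
  obtain ⟨T, hT, -, u, p, hu0, hmax, hLH⟩ :=
    CompactAmplification.exists_isMaximalSmoothSolution_of_katoMaximalTime_lt_top one_pos hsm hdiv
      hdec (lt_top_iff_ne_top.2 htop)
  subst hu0
  exact absurd hsmall (not_le.2 (h hT hmax hLH hdec hax hΩ hV hΓ))

/-- **The crux holds on Lei–Zhang's small-swirl class (unconditionally, `ν = 1`).** There is an
absolute `δ > 0` such that for every smooth, rapidly decaying, divergence-free, axisymmetric datum
`u₀` with `ω₀^θ/r`, `(u₀^θ)²/r`, `Γ₀ ∈ L²` and `‖Γ₀‖_{L^∞} ≤ δ / M₀(u₀)` — no size restriction on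
the poloidal part — and every horizon `T₀ > 0`, one constant bounds the critical envelope
`‖ξ‖² ‖V(t,ξ)‖` along every Fourier-mild solution of unit viscosity from `𝓕u₀` on `[0, T]`,
`T ≤ T₀` (`exists_delta_katoMaximalTime_eq_top_of_smallSwirl` and
`Kato.envelope_of_lt_katoMaximalTime`). [cite: LeiZhang2017, Thm. 1.4] -/
theorem exists_delta_envelope_of_smallSwirl :
    ∃ δ : ℝ, 0 < δ ∧ ∀ {u₀ : EuclideanSpace ℝ (Fin 3) → EuclideanSpace ℝ (Fin 3)}
      (hu : ContDiff ℝ (⊤ : ℕ∞) u₀) (hd : HasRapidSpatialDecay u₀),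
      NSWave0.IsDivFree u₀ → IsAxisymmetric u₀ →
      eLpNorm (LeiZhang2017.bigOmega u₀) 2 volume < ⊤ → eLpNorm (LeiZhang2017.vSq u₀) 2 volume < ⊤ →
      eLpNorm (swirl u₀) 2 volume < ⊤ →
      eLpNorm (swirl u₀) ⊤ volume ≤ ENNReal.ofReal δ / LeiZhang2017.M0 u₀ →
      ∀ T₀ : ℝ, 0 < T₀ → ∃ C : ℝ, ∀ T : ℝ, T ≤ T₀ →
        ∀ V : ℝ → EuclideanSpace ℝ (Fin 3) → Fin 3 → ℂ,
          IsFourierMild (4 * Real.pi ^ 2 * 1) 4 0 T V → V 0 = fourierData hu hd →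
          ∀ t ∈ Set.Icc 0 T, ∀ ξ : EuclideanSpace ℝ (Fin 3), ‖ξ‖ ^ 2 * ‖V t ξ‖ ≤ C := by
  obtain ⟨δ, hδ, h⟩ := exists_delta_katoMaximalTime_eq_top_of_smallSwirl
  refine ⟨δ, hδ, fun {u₀} hu hd hdiv hax hΩ hV hΓ hsmall T₀ hT₀ => ?_⟩
  exact Kato.envelope_of_lt_katoMaximalTime one_pos hu hd hdiv hT₀
    (by
      rw [h hu (fun x => hdiv x) hd hax hΩ hV hΓ hsmall]
      exact ENNReal.ofReal_lt_top)

end Summit.NavierStokesRegularity.NavierStokesRegularity.Theorems.EnvelopeBound.Axisymmetric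

end
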